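import Summits.NavierStokesRegularity.NavierStokesRegularity.Theorems.GaldiLiouvilleGateRecordZoomAncientOscillationBump
import Summits.NavierStokesRegularity.NavierStokesRegularity.Theorems.GaldiLiouvilleGateRecordZoomAncientPersistentBump
import Summits.NavierStokesRegularity.NavierStokesRegularity.Theorems.GaldiLiouvilleGateRecordZoomAncientFaintnessFloor
import HarnessLib.Audit

/-!
# Closed twin of the skeleton `Cruxes/RecordZoomAncient/Lines/birth.lean` — reshapes r7–r8 (lead c4, 2026-08-17)

Sorry-free companion of the r7/r8 skeletons of the crux `GaldiLiouvilleGate.RecordZoomAncient`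
(stmt-NavierStokesRegularity-0894). Everything here is a re-export BY NAME of theorems that are IN THE TREE
(namespace `Summit.NavierStokesRegularity.NavierStokesRegularity.Theorems.RecordZoomAncient.Birth`):

* `RecordZoomAncient_of_oscillationKernel` — the crux from the r8 kernel (stub `stub_oscillationKernel` verbatim) =
  `recordZoomAncient_of_oscillationKernel` (p166059); `RecordZoomAncientAt_of_oscillationBump` — the r8 rung (p166059);
* `RecordZoomAncient_of_diffuseFaintKernel` — the crux from the r7 kernel (stub `stub_diffuseFaintKernel` of
  `Lines/birth.lean` verbatim as a hypothesis) = `recordZoomAncient_of_diffuseFaintKernel` (p163700):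
  split on a persistent isolated critical bump — yes: the rung; no: the pointwise r5 composition `stub_kernelAt`
  (p162337) fed with the kernel;
* `RecordZoomAncientAt_of_persistentBump` — the new rung (p163700): a persistent isolated critical bump
  (velocity-normalised KNSS zoom at one bump: `stub_localZoomLimit` p162715, `stub_zoomNondegenerate` p162658,
  `stub_cutoffEnstrophy` p162991, `stub_normalise` p162442) gives the conclusion of the crux;
* `enstrophy_le_kineticEnergy_mul_velocitySq'` — the faintness floor (p162539).

The r6 closed twins (`recordZoomAncient_of_noFaintBlowupKernel : Kernel(r5) → Z`,
`recordZoomAncient_of_frequentCriticalVelocity : FCV → Z`, p158940) remain valid and in the tree; the r7 kernel is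
implied by the r6 one (drop hypothesis (5)).
-/

noncomputable section

open Set MeasureTheory Filter Topology Function
open scoped ENNReal NNReal
open Literature.Analysis.FluidPDE

namespace Summit.NavierStokesRegularity.NavierStokesRegularity.Cruxes.RecordZoomAncient.Birth

set_option linter.dupNamespace false

/-- Closed twin (r8): the crux from the oscillation kernel, BY NAME — re-export of the tree theorem
`recordZoomAncient_of_oscillationKernel` (p166059). -/
theorem RecordZoomAncient_of_oscillationKernel :
    (∀ (ν T : ℝ), 0 < ν → 0 < T → ∀ (u : ℝ → EuclideanSpace ℝ (Fin 3) → EuclideanSpace ℝ (Fin 3)) (p : ℝ →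
      EuclideanSpace ℝ (Fin 3) → ℝ), IsClassicalNSSolutionOn (Set.Ico 0 T) ν 0 u p → IsLerayHopfOn T ν 0 (u 0)
      u → HasRapidSpatialDecay (u 0) → ¬ HasSmoothExtensionPast ν 0 u T → (∀ C : ℝ, 0 < C → ∃ t' ∈ Set.Ico 0 T,
      ∀ t ∈ Set.Ico t' T, ∃ s ∈ Set.Icc 0 t, ENNReal.ofReal (C * (ν * Real.sqrt ν) / Real.sqrt (T - t)) < ∫⁻ x,
      ENNReal.ofReal (frobeniusNormSq (fderiv ℝ (u s) x))) → (∀ K : ℝ, 0 < K → ∃ t' ∈ Set.Ico 0 T, ∀ t₁ ∈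
      Set.Ico t' T, ∀ t₂ ∈ Set.Ioo t₁ T, ∀ L : ℝ, 0 < L → (∀ s ∈ Set.Icc 0 t₂, (∫⁻ x, ENNReal.ofReal
      (frobeniusNormSq (fderiv ℝ (u s) x))) ≤ ENNReal.ofReal (2 * L)) → (∫⁻ x, ENNReal.ofReal (frobeniusNormSq
      (fderiv ℝ (u t₁) x))) ≤ ENNReal.ofReal L → ENNReal.ofReal (2 * L) ≤ (∫⁻ x, ENNReal.ofReal
      (frobeniusNormSq (fderiv ℝ (u t₂) x))) → K * ν ^ 3 / L ^ 2 ≤ t₂ - t₁) → (∀ R ε : ℝ, 0 < R → 0 < ε → ∃ t'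
      ∈ Set.Ico 0 T, ∀ t ∈ Set.Ico t' T, ∀ x : EuclideanSpace ℝ (Fin 3), ∀ L : ℝ, 0 < L → (∀ s ∈ Set.Icc 0 t,
      (∫⁻ x, ENNReal.ofReal (frobeniusNormSq (fderiv ℝ (u s) x))) ≤ ENNReal.ofReal L) → 3 * ν ^ 3 / L ^ 2 ≤ t →
      (∫⁻ y in Metric.ball x (R * ν ^ 2 / L), ENNReal.ofReal (frobeniusNormSq (fderiv ℝ (u t) y))) <
      ENNReal.ofReal (ε * L)) → (∀ θ : ℝ, 0 < θ → ∃ t' ∈ Set.Ico 0 T, ∀ t ∈ Set.Ico t' T, ∀ x : EuclideanSpace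
      ℝ (Fin 3), ∀ L : ℝ, 0 < L → (∀ s ∈ Set.Icc 0 t, (∫⁻ x, ENNReal.ofReal (frobeniusNormSq (fderiv ℝ (u s)
      x))) ≤ ENNReal.ofReal L) → ‖u t x‖ < θ * L / ν) → (∀ (tc : ℕ → ℝ) (x₁ x₂ : ℕ → EuclideanSpace ℝ (Fin 3))
      (M : ℕ → ℝ) (θ R₀ D : ℝ), (∀ n, 0 < tc n ∧ tc n < T) → (∀ n, 0 < M n) → (∀ n, ∀ t ∈ Set.Icc 0 (tc n), ∀
      x, ‖u t x‖ ≤ M n) → Filter.Tendsto (fun n => tc n * M n ^ 2) Filter.atTop Filter.atTop → 0 < θ → 0 < R₀ →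
      (∀ n, ‖x₁ n - x₂ n‖ ≤ R₀ * (ν / M n)) → (∀ n, θ * M n ≤ ‖u (tc n) (x₁ n) - u (tc n) (x₂ n)‖) → (∀ R S :
      ℝ, 0 < R → 0 < S → ∀ᶠ n in Filter.atTop, ∀ t ∈ Set.Icc 0 (tc n), tc n - S * (ν / M n ^ 2) ≤ t → (∫⁻ y in
      Metric.ball (x₁ n) (R * (ν / M n)), ENNReal.ofReal (frobeniusNormSq (fderiv ℝ (u t) y))) ≤ ENNReal.ofReal
      (D * (ν * M n))) → False) → False) →
      Summit.NavierStokesRegularity.NavierStokesRegularity.Theses.GaldiLiouvilleGate.RecordZoomAncient :=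
  Theorems.RecordZoomAncient.Birth.recordZoomAncient_of_oscillationKernel

/-- Closed twin (r8): the oscillation-bump rung — re-export of the tree theorem
`recordZoomAncientAt_of_oscillationBump` (p166059). -/
theorem RecordZoomAncientAt_of_oscillationBump :
    ∀ (ν T : ℝ), 0 < ν → 0 < T → ∀ (u : ℝ → EuclideanSpace ℝ (Fin 3) → EuclideanSpace ℝ (Fin 3)) (p : ℝ →
      EuclideanSpace ℝ (Fin 3) → ℝ), IsClassicalNSSolutionOn (Set.Ico 0 T) ν 0 u p → IsLerayHopfOn T ν 0 (u 0)
      u → ∀ (tc : ℕ → ℝ) (x₁ x₂ : ℕ → EuclideanSpace ℝ (Fin 3)) (M : ℕ → ℝ) (θ R₀ D : ℝ), (∀ n, 0 < tc n ∧ tc n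
      < T) → (∀ n, 0 < M n) → (∀ n, ∀ t ∈ Set.Icc 0 (tc n), ∀ x, ‖u t x‖ ≤ M n) → Filter.Tendsto (fun n => tc n
      * M n ^ 2) Filter.atTop Filter.atTop → 0 < θ → 0 < R₀ → (∀ n, ‖x₁ n - x₂ n‖ ≤ R₀ * (ν / M n)) → (∀ n, θ *
      M n ≤ ‖u (tc n) (x₁ n) - u (tc n) (x₂ n)‖) → (∀ R S : ℝ, 0 < R → 0 < S → ∀ᶠ n in Filter.atTop, ∀ t ∈
      Set.Icc 0 (tc n), tc n - S * (ν / M n ^ 2) ≤ t → (∫⁻ y in Metric.ball (x₁ n) (R * (ν / M n)),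
      ENNReal.ofReal (frobeniusNormSq (fderiv ℝ (u t) y))) ≤ ENNReal.ofReal (D * (ν * M n))) → ∃ v : ℝ →
      EuclideanSpace ℝ (Fin 3) → EuclideanSpace ℝ (Fin 3), IsBoundedAncientMildSolution 1 v ∧ ContDiffOn ℝ (⊤ :
      ℕ∞) (Function.uncurry v) (Set.Iio 0 ×ˢ Set.univ) ∧ (∀ s < 0, ∫⁻ y, ENNReal.ofReal (frobeniusNormSq
      (fderiv ℝ (v s) y)) ≤ 1) ∧ (∀ s < 0, MeasureTheory.MemLp (v s) 6 MeasureTheory.volume) ∧ ¬ (∀ s < 0, ∀ y,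
      v s y = 0) :=
  Theorems.RecordZoomAncient.Birth.recordZoomAncientAt_of_oscillationBump

/-- Closed twin (r7): the crux from the diffuse-faint kernel, BY NAME — re-export of the tree theorem
`recordZoomAncient_of_diffuseFaintKernel` (p163700). -/
theorem RecordZoomAncient_of_diffuseFaintKernel :
    (∀ (ν T : ℝ), 0 < ν → 0 < T →
      ∀ (u : ℝ → EuclideanSpace ℝ (Fin 3) → EuclideanSpace ℝ (Fin 3)) (p : ℝ → EuclideanSpace ℝ (Fin 3) → ℝ),
        IsClassicalNSSolutionOn (Set.Ico 0 T) ν 0 u p → IsLerayHopfOn T ν 0 (u 0) u →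
        HasRapidSpatialDecay (u 0) → ¬ HasSmoothExtensionPast ν 0 u T →
        (∀ C : ℝ, 0 < C → ∃ t' ∈ Set.Ico 0 T, ∀ t ∈ Set.Ico t' T, ∃ s ∈ Set.Icc 0 t,
            ENNReal.ofReal (C * (ν * Real.sqrt ν) / Real.sqrt (T - t)) <
              ∫⁻ x, ENNReal.ofReal (frobeniusNormSq (fderiv ℝ (u s) x))) →
        (∀ K : ℝ, 0 < K → ∃ t' ∈ Set.Ico 0 T, ∀ t₁ ∈ Set.Ico t' T, ∀ t₂ ∈ Set.Ioo t₁ T, ∀ L : ℝ, 0 < L →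
            (∀ s ∈ Set.Icc 0 t₂,
              (∫⁻ x, ENNReal.ofReal (frobeniusNormSq (fderiv ℝ (u s) x))) ≤ ENNReal.ofReal (2 * L)) →
            (∫⁻ x, ENNReal.ofReal (frobeniusNormSq (fderiv ℝ (u t₁) x))) ≤ ENNReal.ofReal L →
            ENNReal.ofReal (2 * L) ≤ (∫⁻ x, ENNReal.ofReal (frobeniusNormSq (fderiv ℝ (u t₂) x))) →
            K * ν ^ 3 / L ^ 2 ≤ t₂ - t₁) →
        (∀ R ε : ℝ, 0 < R → 0 < ε → ∃ t' ∈ Set.Ico 0 T, ∀ t ∈ Set.Ico t' T,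
            ∀ x : EuclideanSpace ℝ (Fin 3), ∀ L : ℝ, 0 < L →
            (∀ s ∈ Set.Icc 0 t,
              (∫⁻ x, ENNReal.ofReal (frobeniusNormSq (fderiv ℝ (u s) x))) ≤ ENNReal.ofReal L) →
            3 * ν ^ 3 / L ^ 2 ≤ t →
            (∫⁻ y in Metric.ball x (R * ν ^ 2 / L), ENNReal.ofReal (frobeniusNormSq (fderiv ℝ (u t) y))) <
              ENNReal.ofReal (ε * L)) →
        (∀ θ : ℝ, 0 < θ → ∃ t' ∈ Set.Ico 0 T, ∀ t ∈ Set.Ico t' T,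
            ∀ x : EuclideanSpace ℝ (Fin 3), ∀ L : ℝ, 0 < L →
            (∀ s ∈ Set.Icc 0 t,
              (∫⁻ x, ENNReal.ofReal (frobeniusNormSq (fderiv ℝ (u s) x))) ≤ ENNReal.ofReal L) →
            ‖u t x‖ < θ * L / ν) →
        (∀ (tc : ℕ → ℝ) (xc : ℕ → EuclideanSpace ℝ (Fin 3)) (M : ℕ → ℝ) (θ D D₆ : ℝ),
          (∀ n, 0 < tc n ∧ tc n < T) → (∀ n, 0 < M n) →
          (∀ n, ∀ t ∈ Set.Icc 0 (tc n), ∀ x, ‖u t x‖ ≤ M n) →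
          Tendsto (fun n => tc n * M n ^ 2) atTop atTop →
          0 < θ → (∀ n, θ * M n ≤ ‖u (tc n) (xc n)‖) →
          (∀ R S : ℝ, 0 < R → 0 < S → ∀ᶠ n in atTop, ∀ t ∈ Set.Icc 0 (tc n), tc n - S * (ν / M n ^ 2) ≤ t →
            (∫⁻ y in Metric.ball (xc n) (R * (ν / M n)), ENNReal.ofReal (frobeniusNormSq (fderiv ℝ (u t) y))) ≤
              ENNReal.ofReal (D * (ν * M n))) →
          (∀ R S : ℝ, 0 < R → 0 < S → ∀ᶠ n in atTop, ∀ t ∈ Set.Icc 0 (tc n), tc n - S * (ν / M n ^ 2) ≤ t →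
            (∫⁻ y in Metric.ball (xc n) (R * (ν / M n)), ‖u t y‖ₑ ^ (6 : ℕ)) ≤
              ENNReal.ofReal (D₆ * (ν * M n) ^ 3)) →
          False) →
        False) →
    Theses.GaldiLiouvilleGate.RecordZoomAncient :=
  Theorems.RecordZoomAncient.Birth.recordZoomAncient_of_diffuseFaintKernel

/-- Closed twin (r7): the persistent-bump rung — re-export of the tree theorem
`recordZoomAncientAt_of_persistentBump` (p163700). -/
theorem RecordZoomAncientAt_of_persistentBump :
    ∀ (ν T : ℝ), 0 < ν → 0 < T → ∀ (u : ℝ → EuclideanSpace ℝ (Fin 3) → EuclideanSpace ℝ (Fin 3)) (p : ℝ →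
      EuclideanSpace ℝ (Fin 3) → ℝ), IsClassicalNSSolutionOn (Set.Ico 0 T) ν 0 u p → IsLerayHopfOn T ν 0 (u 0)
      u → ∀ (tc : ℕ → ℝ) (xc : ℕ → EuclideanSpace ℝ (Fin 3)) (M : ℕ → ℝ) (θ D D₆ : ℝ), (∀ n, 0 < tc n ∧ tc n <
      T) → (∀ n, 0 < M n) → (∀ n, ∀ t ∈ Set.Icc 0 (tc n), ∀ x, ‖u t x‖ ≤ M n) → Filter.Tendsto (fun n => tc n *
      M n ^ 2) Filter.atTop Filter.atTop → 0 < θ → (∀ n, θ * M n ≤ ‖u (tc n) (xc n)‖) → (∀ R S : ℝ, 0 < R → 0 <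
      S → ∀ᶠ n in Filter.atTop, ∀ t ∈ Set.Icc 0 (tc n), tc n - S * (ν / M n ^ 2) ≤ t → (∫⁻ y in Metric.ball (xc
      n) (R * (ν / M n)), ENNReal.ofReal (frobeniusNormSq (fderiv ℝ (u t) y))) ≤ ENNReal.ofReal (D * (ν * M
      n))) → (∀ R S : ℝ, 0 < R → 0 < S → ∀ᶠ n in Filter.atTop, ∀ t ∈ Set.Icc 0 (tc n), tc n - S * (ν / M n ^ 2)
      ≤ t → (∫⁻ y in Metric.ball (xc n) (R * (ν / M n)), ‖u t y‖ₑ ^ (6 : ℕ)) ≤ ENNReal.ofReal (D₆ * (ν * M n) ^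
      3)) → ∃ v : ℝ → EuclideanSpace ℝ (Fin 3) → EuclideanSpace ℝ (Fin 3), IsBoundedAncientMildSolution 1 v ∧
      ContDiffOn ℝ (⊤ : ℕ∞) (Function.uncurry v) (Set.Iio 0 ×ˢ Set.univ) ∧ (∀ s < 0, ∫⁻ y, ENNReal.ofReal
      (frobeniusNormSq (fderiv ℝ (v s) y)) ≤ 1) ∧ (∀ s < 0, MeasureTheory.MemLp (v s) 6 MeasureTheory.volume) ∧
      ¬ (∀ s < 0, ∀ y, v s y = 0) :=
  Theorems.RecordZoomAncient.Birth.recordZoomAncientAt_of_persistentBump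

/-- Closed twin (r7): the faintness floor — re-export of the tree theorem
`enstrophy_le_kineticEnergy_mul_velocitySq` (p162539). -/
theorem enstrophy_le_kineticEnergy_mul_velocitySq' :
    ∀ (ν T : ℝ), 0 < ν → 0 < T → ∀ (u : ℝ → EuclideanSpace ℝ (Fin 3) → EuclideanSpace ℝ (Fin 3)) (p : ℝ →
      EuclideanSpace ℝ (Fin 3) → ℝ), IsClassicalNSSolutionOn (Set.Ico 0 T) ν 0 u p → IsLerayHopfOn T ν 0 (u 0)
      u → HasRapidSpatialDecay (u 0) → ∀ t ∈ Set.Ico 0 T, ∀ M : ℝ, 0 < M → ν / M ^ 2 ≤ t → (∀ s ∈ Set.Icc 0 t,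
      ∀ x, ‖u s x‖ ≤ M) → ∫⁻ x, ENNReal.ofReal (frobeniusNormSq (fderiv ℝ (u t) x)) ≤ ENNReal.ofReal (Real.exp
      (1 / 2) * VectorCalculus.kineticEnergy (u 0) * M ^ 2 / ν ^ 2) :=
  Theorems.RecordZoomAncient.Birth.enstrophy_le_kineticEnergy_mul_velocitySq

end Summit.NavierStokesRegularity.NavierStokesRegularity.Cruxes.RecordZoomAncient.Birth

end
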